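import Mathlib.Probability.Kernel.Composition.Comp
import Mathlib.MeasureTheory.Measure.Portmanteau
import Mathlib.MeasureTheory.Measure.ProbabilityMeasure
import Mathlib.MeasureTheory.Measure.OpenPos
import Mathlib.MeasureTheory.Measure.WithDensity
import HarnessLib

/-!
# Small sets for Markov semigroups: every compact set is small for all large times

Trunk T-STOCH (Literature/Probability/Process). Theorems only (no new definitions). For a
semigroup of Markov kernels `(κ t)_{t ≥ 0}` on a topological (metrisable) Borel space
(`κ (s + t) = κ t ∘ₖ κ s`) which is **Feller** and **topologically irreducible** (every open set
is reached with positive probability from every point) and which admits ONE local minorisation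
("local small set": an open set `G₀`, a measure `ν₀` charging every neighbourhood of some point,
and a time window `[t₀ - δ, t₀ + δ]` with `κ t (w, ·) ≥ ν₀` for `w ∈ G₀` and `t` in the window),
EVERY COMPACT SET IS SMALL FOR ALL LARGE TIMES: for every compact `C` there is `t_C` such that for
all `t ≥ t_C`, `κ t (z, ·) ≥ ε ν₀` for all `z ∈ C`, with some `ε = ε(t) > 0`. A local small set
exists as soon as the kernels have a jointly continuous density with respect to a reference
measure (`exists_local_small_of_density`), so this is the abstract content of
Cuneo–Eckmann–Hairer–Rey-Bellet 2018, Proposition 3.6 ("Assume H1 [smooth transition densities,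
irreducibility]. Then, for every compact set `C`, there exists a time `t_C` such that for all
`t ≥ t_C`, there exists a non-negative and non-trivial measure `ν` … such that `P_t(z, ·) ≥ ν` for
all `z ∈ C`"), in the language of Meyn–Tweedie small sets.

## Main results

* `Literature.Probability.Process.MarkovSemigroup.mul_apply_le_comp_apply`,
  `….smul_le_comp` — Chapman–Kolmogorov lower bounds
  `κ (s+t) (z, A) ≥ κ s (z, G) · inf_{w ∈ G} κ t (w, A)`.
* `….pow_le_apply_of_window` — iterating a return bound over time windows:
  `κ u (w, G) ≥ cᵏ` for `u ∈ [ka, kb]`, `w ∈ G`.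
* `….eventually_lt_apply_of_isOpen`, `….exists_isOpen_le_apply_of_pos` — Feller ⟹
  `z ↦ κ t (z, U)` is lower semicontinuous for open `U` (portmanteau), hence uniformly positive
  near a point of positivity.
* `….exists_smul_le_of_isCompact` — **the small-set theorem** above.
* `….exists_local_small_of_density` — a jointly continuous density at positive times gives a
  local small set around every point and time.
* `….exists_smul_le_of_isCompact_of_mem`, `….exists_smul_restrict_le_of_isCompact_of_mem` —
  POINTED forms: irreducibility is only needed towards the neighbourhoods of the base point of the
  local small set.
* `….exists_smul_restrict_le_of_isCompact` — the two combined (CEHR Prop. 3.6, abstract form):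
  continuous densities w.r.t. an open-positive reference measure `λ` + irreducibility + Feller ⟹
  for every compact `C` and all large `t`, `κ t (z, ·) ≥ ε · λ|_U` on `C` for a fixed nonempty open
  `U` and some `ε = ε(t) > 0`.

## Proof (CEHR 2018, proof of Prop. 3.6, reorganised at the level of measures of open sets)

Let `(G₀, ν₀, [t₀-δ, t₀+δ])` be a local small set and `y₀` a point all of whose neighbourhoods are
charged by `ν₀`. Irreducibility gives a return time `s₀` with `κ s₀ (y₀, G₀) > 0`, and lower
semicontinuity an open `V₁ ∋ y₀` on which `κ s₀ (·, G₀) ≥ c₁ > 0`; hence (Chapman–Kolmogorov)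
`κ u (w, G₀) ≥ c₂ = c₁ ν₀(V₁) > 0` for all `w ∈ G₀` and `u` in the window `[a, b]`,
`a = t₀ - δ + s₀`, `b = t₀ + δ + s₀`. Iterating, `κ u (w, G₀) ≥ c₂ᵏ` on `[ka, kb]`, and these windows
cover `[max(b, ab/(b-a)), ∞)` ("aperiodicity"). Landing once more with the local small set,
`κ T (w, ·) ≥ c(T) ν₀` for all `w ∈ G₀` and all large `T`. Finally a compact `C` is covered by
finitely many open sets on each of which some `κ s_i (·, G₀) ≥ a_i > 0` (irreducibility + lower
semicontinuity), and Chapman–Kolmogorov gives `κ t (z, ·) ≥ (∏ a_i c(t - s_i)) ν₀` on `C`.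

## References

* N. Cuneo, J.-P. Eckmann, M. Hairer, L. Rey-Bellet, *Non-equilibrium steady states for
  networks of oscillators*, Electron. J. Probab. 23 (2018) no. 55 (arXiv:1712.09413), §3.2,
  Prop. 3.6 and its proof.
* S. P. Meyn, R. L. Tweedie, *Markov Chains and Stochastic Stability*, Springer (1993), Ch. 5
  (small sets), Ch. 6 (T-chains: Prop. 6.2.8, every compact set is petite for an irreducible
  T-chain).

## Design choices

* No structure: the hypotheses (Markov kernels indexed by `ℝ≥0`, Chapman–Kolmogorov in Mathlib's
  `∘ₖ` spelling, Feller on `X →ᵇ ℝ`) are the fields of the Langevin-chain interface of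
  `Literature/MathematicalPhysics/KineticTheory/LangevinSemigroup.lean`, unbundled as in
  `KrylovBogoliubov.lean`.
* Time windows are written with real inequalities `a ≤ (t : ℝ) ≤ b` to avoid truncated
  subtraction in `ℝ≥0`.
* The minorising measures are `ε • ν₀` with the SAME `ν₀` for all compact sets and times (only
  `ε` depends on them), slightly more than the printed "which may depend on `t`".
-/

noncomputable section

open MeasureTheory ProbabilityTheory Filter Topology Set
open scoped NNReal ENNReal BoundedContinuousFunction

namespace Literature.Probability.Process.MarkovSemigroup

variable {X : Type*} [MeasurableSpace X]

/-! ### Chapman–Kolmogorov lower bounds -/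

/-- **Chapman–Kolmogorov lower bound** (scalar form): if `κ t (w, A) ≥ c` for all `w ∈ G`, then
`κ (s+t) (z, A) ≥ c · κ s (z, G)`. [folklore] -/
theorem mul_apply_le_comp_apply (κ : ℝ≥0 → Kernel X X)
    (h_add : ∀ s t : ℝ≥0, κ (s + t) = κ t ∘ₖ κ s) (s t : ℝ≥0) (z : X) {G A : Set X}
    (hA : MeasurableSet A) {c : ℝ≥0∞} (hc : ∀ w ∈ G, c ≤ κ t w A) :
    c * κ s z G ≤ κ (s + t) z A := by
  rw [h_add, Kernel.comp_apply' _ _ _ hA]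
  calc c * κ s z G = ∫⁻ _ in G, c ∂(κ s z) := by rw [setLIntegral_const]
    _ ≤ ∫⁻ w in G, κ t w A ∂(κ s z) := setLIntegral_mono (Kernel.measurable_coe _ hA) hc
    _ ≤ ∫⁻ w, κ t w A ∂(κ s z) := setLIntegral_le_lintegral _ _

/-- **Chapman–Kolmogorov lower bound** (measure form): if `κ t (w, ·) ≥ ν` for all `w ∈ G`, then
`κ (s+t) (z, ·) ≥ κ s (z, G) • ν`. [folklore] -/
theorem smul_le_comp (κ : ℝ≥0 → Kernel X X) (h_add : ∀ s t : ℝ≥0, κ (s + t) = κ t ∘ₖ κ s)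
    (s t : ℝ≥0) (z : X) (G : Set X) {ν : Measure X} (hν : ∀ w ∈ G, ν ≤ κ t w) :
    (κ s z G) • ν ≤ κ (s + t) z := by
  refine Measure.le_iff.2 fun A hA => ?_
  rw [Measure.smul_apply, smul_eq_mul, mul_comm]
  exact mul_apply_le_comp_apply κ h_add s t z hA fun w hw => Measure.le_iff'.1 (hν w hw) A

/-! ### Iterating a return bound over time windows -/

/-- **Iteration over windows**: if `κ u (w, G) ≥ c` for all `w ∈ G` and all times `u` with
`a ≤ u ≤ b` (`0 ≤ a ≤ b`), then `κ u (w, G) ≥ cᵏ` for all `w ∈ G` and `ka ≤ u ≤ kb`, `k ≥ 1`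
(Chapman–Kolmogorov, splitting `u = u₁ + u₂` with `u₁ ∈ [ka, kb]`, `u₂ ∈ [a, b]`). [folklore] -/
theorem pow_le_apply_of_window (κ : ℝ≥0 → Kernel X X)
    (h_add : ∀ s t : ℝ≥0, κ (s + t) = κ t ∘ₖ κ s) {G : Set X} (hG : MeasurableSet G)
    {a b : ℝ} (ha : 0 ≤ a) (hab : a ≤ b) {c : ℝ≥0∞}
    (h : ∀ u : ℝ≥0, a ≤ (u : ℝ) → (u : ℝ) ≤ b → ∀ w ∈ G, c ≤ κ u w G) :
    ∀ k : ℕ, 1 ≤ k → ∀ u : ℝ≥0, k * a ≤ (u : ℝ) → (u : ℝ) ≤ k * b → ∀ w ∈ G, c ^ k ≤ κ u w G := by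
  intro k hk
  induction k with
  | zero => exact absurd hk (by norm_num)
  | succ k ih =>
    intro u hu1 hu2 w hw
    rcases Nat.eq_zero_or_pos k with rfl | hkpos
    · simp only [zero_add, Nat.cast_one, one_mul] at hu1 hu2
      rw [zero_add, pow_one]
      exact h u hu1 hu2 w hw
    · -- split `u = u₁ + u₂`, `u₂ = min b (u - k a) ∈ [a, b]`, `u₁ ∈ [ka, kb]`
      push_cast at hu1 hu2
      set u₂ : ℝ := min b ((u : ℝ) - k * a) with hu₂
      have hk0 : (0 : ℝ) ≤ k := by positivity
      have hu₂a : a ≤ u₂ := le_min hab (by nlinarith)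
      have hu₂b : u₂ ≤ b := min_le_left _ _
      have hu₂0 : 0 ≤ u₂ := ha.trans hu₂a
      have hu₂le : u₂ ≤ (u : ℝ) := by
        have : (u : ℝ) - k * a ≤ u := by nlinarith
        exact (min_le_right _ _).trans this
      set u₁ : ℝ := (u : ℝ) - u₂ with hu₁
      have hu₁0 : 0 ≤ u₁ := sub_nonneg.2 hu₂le
      have hu₁a : k * a ≤ u₁ := by
        rw [hu₁]
        have : u₂ ≤ (u : ℝ) - k * a := min_le_right _ _
        linarith
      have hu₁b : u₁ ≤ k * b := by
        rw [hu₁, hu₂]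
        rcases le_total b ((u : ℝ) - k * a) with hcase | hcase
        · rw [min_eq_left hcase]; linarith
        · rw [min_eq_right hcase]; nlinarith
      have hsplit : u = ⟨u₁, hu₁0⟩ + ⟨u₂, hu₂0⟩ := by
        apply NNReal.eq
        show (u : ℝ) = ((u : ℝ) - u₂) + u₂
        ring
      have ih' := ih hkpos ⟨u₁, hu₁0⟩ hu₁a hu₁b w hw
      have hwin : ∀ w' ∈ G, c ≤ κ ⟨u₂, hu₂0⟩ w' G := fun w' hw' => h ⟨u₂, hu₂0⟩ hu₂a hu₂b w' hw'
      rw [hsplit, pow_succ, mul_comm]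
      exact (mul_le_mul' le_rfl ih').trans
        (mul_apply_le_comp_apply κ h_add _ _ w hG hwin)

/-- **Large times lie in some window** ("aperiodicity"): for `0 ≤ a < b` and
`u ≥ max(b, ab/(b-a))` there is `k ≥ 1` with `ka ≤ u ≤ kb` (take `k = ⌈u/b⌉`). [folklore] -/
theorem exists_nat_mul_le_le_mul {a b : ℝ} (ha : 0 ≤ a) (hab : a < b) {u : ℝ}
    (hu : max b (a * b / (b - a)) ≤ u) : ∃ k : ℕ, 1 ≤ k ∧ k * a ≤ u ∧ u ≤ k * b := by
  have hb : 0 < b := lt_of_le_of_lt ha hab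
  have hub : b ≤ u := (le_max_left _ _).trans hu
  have hu0 : 0 < u := hb.trans_le hub
  refine ⟨⌈u / b⌉₊, ?_, ?_, ?_⟩
  · exact Nat.one_le_ceil_iff.2 (div_pos hu0 hb)
  · have hceil : (⌈u / b⌉₊ : ℝ) < u / b + 1 := Nat.ceil_lt_add_one (div_nonneg hu0.le hb.le)
    have hba : 0 < b - a := sub_pos.2 hab
    have h2 : a * b / (b - a) ≤ u := (le_max_right _ _).trans hu
    rw [div_le_iff₀ hba] at h2
    -- `⌈u/b⌉ a ≤ (u/b + 1) a ≤ u`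
    have h3 : (u / b + 1) * a ≤ u := by
      rw [div_add_one hb.ne', div_mul_eq_mul_div, div_le_iff₀ hb]
      nlinarith
    nlinarith
  · have hceil : u / b ≤ (⌈u / b⌉₊ : ℝ) := Nat.le_ceil _
    rwa [div_le_iff₀ hb] at hceil

/-! ### Feller kernels: lower semicontinuity of the mass of open sets -/

section Feller

variable [TopologicalSpace X] [OpensMeasurableSpace X] [HasOuterApproxClosed X]

/-- **Feller ⟹ lower semicontinuity on open sets** (portmanteau): if `z ↦ ∫ g dκ(z)` is
continuous for every bounded continuous `g`, then for every open `U` and every `c < κ(z, U)` one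
has `c < κ(z', U)` for all `z'` near `z`. [folklore] -/
theorem eventually_lt_apply_of_isOpen (P : Kernel X X) [IsMarkovKernel P]
    (h_feller : ∀ g : X →ᵇ ℝ, Continuous fun x => ∫ y, g y ∂(P x)) {U : Set X} (hU : IsOpen U)
    (z : X) {c : ℝ≥0∞} (hc : c < P z U) : ∀ᶠ z' in 𝓝 z, c < P z' U := by
  -- `z ↦ P z` as a continuous map into `ProbabilityMeasure X`
  let T : X → ProbabilityMeasure X := fun x => ⟨P x, inferInstance⟩
  have hT : Tendsto T (𝓝 z) (𝓝 (T z)) := by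
    rw [ProbabilityMeasure.tendsto_iff_forall_integral_tendsto]
    intro g
    exact ((h_feller g).tendsto z)
  have hlim := ProbabilityMeasure.le_liminf_measure_open_of_tendsto hT hU
  have hlt : c < liminf (fun x => ((T x : ProbabilityMeasure X) : Measure X) U) (𝓝 z) :=
    lt_of_lt_of_le hc hlim
  exact eventually_lt_of_lt_liminf hlt

/-- Uniform positivity near a point of positivity: if `κ(z, U) > 0` for an open `U`, there are an
open `V ∋ z` and `c > 0` with `κ(z', U) ≥ c` for all `z' ∈ V`. [folklore] -/
theorem exists_isOpen_le_apply_of_pos (P : Kernel X X) [IsMarkovKernel P]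
    (h_feller : ∀ g : X →ᵇ ℝ, Continuous fun x => ∫ y, g y ∂(P x)) {U : Set X} (hU : IsOpen U)
    (z : X) (hz : 0 < P z U) :
    ∃ (V : Set X) (c : ℝ≥0∞), IsOpen V ∧ z ∈ V ∧ 0 < c ∧ c ≤ 1 ∧ ∀ z' ∈ V, c ≤ P z' U := by
  have hne : P z U ≠ 0 := hz.ne'
  have htop : P z U ≠ ∞ := measure_ne_top _ _
  have hhalf : P z U / 2 < P z U := ENNReal.half_lt_self hne htop
  have hev := eventually_lt_apply_of_isOpen P h_feller hU z hhalf
  obtain ⟨V, hVsub, hVopen, hzV⟩ := mem_nhds_iff.1 hev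
  refine ⟨V, P z U / 2, hVopen, hzV, ENNReal.half_pos hne, ?_, fun z' hz' => (hVsub hz').le⟩
  exact (ENNReal.half_le_self).trans prob_le_one

end Feller

/-! ### The small-set theorem -/

section SmallSet

variable [TopologicalSpace X] [OpensMeasurableSpace X] [HasOuterApproxClosed X]
  (κ : ℝ≥0 → Kernel X X) [∀ t, IsMarkovKernel (κ t)]
  (h_add : ∀ s t : ℝ≥0, κ (s + t) = κ t ∘ₖ κ s)
  (h_feller : ∀ (t : ℝ≥0) (g : X →ᵇ ℝ), Continuous fun x => ∫ y, g y ∂(κ t x))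
  (h_irred : ∀ (z : X) (U : Set X), IsOpen U → U.Nonempty → ∃ t : ℝ≥0, 0 < κ t z U)

include h_add h_feller h_irred in
/-- **Return bounds for all large times** ("aperiodicity"; CEHR proof of Prop. 3.6, the claims
`p_t(z', z⋆) > 0` for `t ≥ t♯(z)`, `z' ∈ B(z, δ_z)` and `p_t(z⋆, z⋆) > 0` for all `t ≥ t₂`):
given a local small set `(G₀, ν₀, [t₀-δ, t₀+δ])` with `ν₀` charging every neighbourhood of a
point `y₀`, there is `T♭` such that for every `u ≥ T♭` some `c > 0` bounds `κ u (w, G₀) ≥ c` for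
all `w ∈ G₀`. [cite: CuneoEckmannHairerReyBellet2018, Prop 3.6 (proof)] -/
theorem exists_forall_le_apply_of_local_small {G₀ : Set X} (hG₀ : IsOpen G₀) (hG₀ne : G₀.Nonempty)
    {ν₀ : Measure X} {y₀ : X} (hy₀ : ∀ V : Set X, IsOpen V → y₀ ∈ V → 0 < ν₀ V)
    {t₀ δ : ℝ} (hδ : 0 < δ) (hδt : δ ≤ t₀)
    (h_loc : ∀ t : ℝ≥0, t₀ - δ ≤ (t : ℝ) → (t : ℝ) ≤ t₀ + δ → ∀ w ∈ G₀, ν₀ ≤ κ t w) :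
    ∃ T : ℝ, ∀ u : ℝ≥0, T ≤ (u : ℝ) → ∃ c : ℝ≥0∞, 0 < c ∧ c ≤ 1 ∧ ∀ w ∈ G₀, c ≤ κ u w G₀ := by
  -- return from `y₀` to `G₀`
  obtain ⟨s₀, hs₀⟩ := h_irred y₀ G₀ hG₀ hG₀ne
  obtain ⟨V₁, c₁, hV₁, hy₀V₁, hc₁, hc₁1, hret⟩ :=
    exists_isOpen_le_apply_of_pos (κ s₀) (h_feller s₀) hG₀ y₀ hs₀
  have hm₁ : 0 < ν₀ V₁ := hy₀ V₁ hV₁ hy₀V₁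
  -- the cycle: land in `V₁` with mass `≥ ν₀ V₁`, come back with probability `≥ c₁`
  set a : ℝ := t₀ - δ + s₀ with ha
  set b : ℝ := t₀ + δ + s₀ with hb
  have ha0 : 0 ≤ a := by rw [ha]; have := s₀.coe_nonneg; linarith
  have hab : a < b := by rw [ha, hb]; linarith
  set c₂ : ℝ≥0∞ := c₁ * ν₀ V₁ with hc₂
  have hc₂0 : 0 < c₂ := ENNReal.mul_pos hc₁.ne' hm₁.ne'
  have hcycle : ∀ u : ℝ≥0, a ≤ (u : ℝ) → (u : ℝ) ≤ b → ∀ w ∈ G₀, c₂ ≤ κ u w G₀ := by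
    intro u hu1 hu2 w hw
    have hus : (s₀ : ℝ) ≤ u := by rw [ha] at hu1; linarith
    set t : ℝ≥0 := u - s₀ with ht
    have htu : u = t + s₀ := by rw [ht, tsub_add_cancel_of_le (by exact_mod_cast hus)]
    have htreal : ((t : ℝ≥0) : ℝ) = u - s₀ := by
      rw [ht, NNReal.coe_sub (by exact_mod_cast hus)]
    have ht1 : t₀ - δ ≤ (t : ℝ) := by rw [htreal]; rw [ha] at hu1; linarith
    have ht2 : (t : ℝ) ≤ t₀ + δ := by rw [htreal]; rw [hb] at hu2; linarith
    have hland : ν₀ V₁ ≤ κ t w V₁ := Measure.le_iff'.1 (h_loc t ht1 ht2 w hw) V₁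
    rw [htu]
    calc c₂ = c₁ * ν₀ V₁ := rfl
      _ ≤ c₁ * κ t w V₁ := mul_le_mul' le_rfl hland
      _ ≤ κ (t + s₀) w G₀ :=
          mul_apply_le_comp_apply κ h_add t s₀ w hG₀.measurableSet fun w' hw' => hret w' hw'
  -- `c₂ ≤ 1`
  have hc₂1 : c₂ ≤ 1 := by
    obtain ⟨w₀, hw₀⟩ := hG₀ne
    have ht₀0 : 0 ≤ t₀ := hδ.le.trans hδt
    have h1 := hcycle ⟨t₀ + s₀, by have := s₀.coe_nonneg; linarith⟩
      (by show t₀ - δ + (s₀ : ℝ) ≤ t₀ + s₀; linarith)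
      (by show t₀ + (s₀ : ℝ) ≤ t₀ + δ + s₀; linarith) w₀ hw₀
    exact h1.trans prob_le_one
  -- iterate and cover all large times
  have hiter := pow_le_apply_of_window κ h_add hG₀.measurableSet ha0 hab.le hcycle
  refine ⟨max b (a * b / (b - a)), fun u hu => ?_⟩
  obtain ⟨k, hk1, hk2, hk3⟩ := exists_nat_mul_le_le_mul ha0 hab hu
  exact ⟨c₂ ^ k, ENNReal.pow_pos hc₂0 k, pow_le_one' hc₂1 k,
    fun w hw => hiter k hk1 u hk2 hk3 w hw⟩

include h_add h_feller h_irred in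
/-- **Every compact set is small for all large times** (CEHR 2018, Prop. 3.6, abstract form;
Meyn–Tweedie Ch. 5–6): let `(κ t)` be a Feller, topologically irreducible Markov semigroup with a
local small set `(G₀, ν₀, [t₀-δ, t₀+δ])` (`G₀` open nonempty, `0 < δ ≤ t₀`, `κ t (w, ·) ≥ ν₀` for
`w ∈ G₀` and `|t - t₀| ≤ δ`) whose minorising measure `ν₀` charges every neighbourhood of some
point `y₀`. Then for every compact `C` there is `t_C` such that for every `t ≥ t_C` there is
`ε ∈ (0, 1]` with `κ t (z, ·) ≥ ε ν₀` for all `z ∈ C`.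
[cite: CuneoEckmannHairerReyBellet2018, Prop 3.6] -/
theorem exists_smul_le_of_isCompact {G₀ : Set X} (hG₀ : IsOpen G₀) (hG₀ne : G₀.Nonempty)
    {ν₀ : Measure X} {y₀ : X} (hy₀ : ∀ V : Set X, IsOpen V → y₀ ∈ V → 0 < ν₀ V)
    {t₀ δ : ℝ} (hδ : 0 < δ) (hδt : δ ≤ t₀)
    (h_loc : ∀ t : ℝ≥0, t₀ - δ ≤ (t : ℝ) → (t : ℝ) ≤ t₀ + δ → ∀ w ∈ G₀, ν₀ ≤ κ t w)
    {C : Set X} (hC : IsCompact C) :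
    ∃ t_C : ℝ≥0, ∀ t : ℝ≥0, t_C ≤ t → ∃ ε : ℝ≥0∞, 0 < ε ∧ ε ≤ 1 ∧ ∀ z ∈ C, ε • ν₀ ≤ κ t z := by
  classical
  obtain ⟨Tf, hTf⟩ := exists_forall_le_apply_of_local_small κ h_add h_feller h_irred hG₀ hG₀ne hy₀
    hδ hδt h_loc
  have ht₀0 : 0 < t₀ := hδ.trans_le hδt
  set t₀' : ℝ≥0 := ⟨t₀, ht₀0.le⟩ with ht₀'
  have ht₀'coe : (t₀' : ℝ) = t₀ := rfl
  -- landing: for `u ≥ Tf`, `κ (u + t₀) (w, ·) ≥ c(u) ν₀` on `G₀`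
  have hland : ∀ u : ℝ≥0, Tf ≤ (u : ℝ) → ∃ c : ℝ≥0∞, 0 < c ∧ c ≤ 1 ∧
      ∀ w ∈ G₀, c • ν₀ ≤ κ (u + t₀') w := by
    intro u hu
    obtain ⟨c, hc0, hc1, hc⟩ := hTf u hu
    refine ⟨c, hc0, hc1, fun w hw => ?_⟩
    have h1 : (κ u w G₀) • ν₀ ≤ κ (u + t₀') w :=
      smul_le_comp κ h_add u t₀' w G₀ fun w' hw' => h_loc t₀' (by rw [ht₀'coe]; linarith)
        (by rw [ht₀'coe]; linarith) w' hw'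
    exact (IsOrderedSMul.smul_le_smul_right _ _ (hc w hw) ν₀).trans h1
  -- each point of `C` reaches `G₀` with uniformly positive probability on a neighbourhood
  have hreach : ∀ z : X, ∃ (s : ℝ≥0) (a : ℝ≥0∞) (Nz : Set X), IsOpen Nz ∧ z ∈ Nz ∧ 0 < a ∧ a ≤ 1 ∧
      ∀ z' ∈ Nz, a ≤ κ s z' G₀ := by
    intro z
    obtain ⟨s, hs⟩ := h_irred z G₀ hG₀ hG₀ne
    obtain ⟨V, a, hV, hzV, ha0, ha1, hV'⟩ := exists_isOpen_le_apply_of_pos (κ s) (h_feller s) hG₀ z hs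
    exact ⟨s, a, V, hV, hzV, ha0, ha1, hV'⟩
  choose s a Nz hNo hzN ha0 ha1 hbound using hreach
  obtain ⟨F, hFC, hcover⟩ := hC.elim_nhds_subcover Nz fun z _ => (hNo z).mem_nhds (hzN z)
  -- the time `t_C`
  set S : ℝ≥0 := F.sup s with hS
  have hsS : ∀ z ∈ F, s z ≤ S := fun z hz => Finset.le_sup hz
  set M : ℝ≥0 := ⟨max Tf 0, le_max_right _ _⟩ with hM
  have hMcoe : (M : ℝ) = max Tf 0 := rfl
  refine ⟨M + t₀' + S, fun t ht => ?_⟩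
  -- for `z ∈ Nz zᵢ`: `κ t (z, ·) ≥ a zᵢ • c(t - s zᵢ - t₀) • ν₀`
  have hdecomp : ∀ z ∈ F, ∃ u : ℝ≥0, Tf ≤ (u : ℝ) ∧ t = s z + (u + t₀') := by
    intro z hz
    have h1 : s z + t₀' + M ≤ t := by
      calc s z + t₀' + M ≤ S + t₀' + M := by gcongr; exact hsS z hz
        _ = M + t₀' + S := by ring
        _ ≤ t := ht
    have h2 : s z + t₀' ≤ t := le_trans le_self_add h1
    refine ⟨t - (s z + t₀'), ?_, ?_⟩
    · have hcoe : (((t - (s z + t₀') : ℝ≥0)) : ℝ) = t - (s z + t₀') := NNReal.coe_sub h2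
      have h1' : ((s z + t₀' + M : ℝ≥0) : ℝ) ≤ t := by exact_mod_cast h1
      rw [NNReal.coe_add, NNReal.coe_add, hMcoe] at h1'
      rw [hcoe]
      have : Tf ≤ max Tf 0 := le_max_left _ _
      linarith
    · rw [add_comm (t - (s z + t₀')) t₀', ← add_assoc, add_tsub_cancel_of_le h2]
  choose! u hu ht_eq using hdecomp
  have hc : ∀ z ∈ F, ∃ c : ℝ≥0∞, 0 < c ∧ c ≤ 1 ∧ ∀ w ∈ G₀, c • ν₀ ≤ κ (u z + t₀') w :=
    fun z hz => hland (u z) (hu z hz)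
  choose! c hc0 hc1 hcland using hc
  -- `ε = ∏ (a zᵢ * c zᵢ)`
  set ε : ℝ≥0∞ := ∏ z ∈ F, a z * c z with hε
  have hε0 : 0 < ε := by
    rw [hε, pos_iff_ne_zero, Finset.prod_ne_zero_iff]
    exact fun z hz => mul_ne_zero (ha0 z).ne' (hc0 z hz).ne'
  have hfac1 : ∀ z ∈ F, a z * c z ≤ 1 := fun z hz => mul_le_one' (ha1 z) (hc1 z hz)
  have hε1 : ε ≤ 1 := Finset.prod_le_one' hfac1
  have hεle : ∀ z ∈ F, ε ≤ a z * c z := by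
    intro z hz
    rw [hε, ← Finset.mul_prod_erase F (fun z => a z * c z) hz]
    exact mul_le_of_le_one_right' (Finset.prod_le_one' fun w hw => hfac1 w (Finset.mem_of_mem_erase hw))
  refine ⟨ε, hε0, hε1, fun z hz => ?_⟩
  -- pick the index `zᵢ` with `z ∈ Nz zᵢ`
  obtain ⟨zi, hziF, hzNi⟩ : ∃ zi ∈ F, z ∈ Nz zi := by
    have := hcover hz
    simp only [mem_iUnion, exists_prop] at this
    exact this
  have h1 : (κ (s zi) z G₀) • (c zi • ν₀) ≤ κ (s zi + (u zi + t₀')) z :=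
    smul_le_comp κ h_add (s zi) (u zi + t₀') z G₀ fun w hw => hcland zi hziF w hw
  rw [← ht_eq zi hziF] at h1
  calc ε • ν₀ ≤ (a zi * c zi) • ν₀ := IsOrderedSMul.smul_le_smul_right _ _ (hεle zi hziF) ν₀
    _ ≤ (κ (s zi) z G₀ * c zi) • ν₀ :=
        IsOrderedSMul.smul_le_smul_right _ _ (mul_le_mul' (hbound zi z hzNi) le_rfl) ν₀
    _ = (κ (s zi) z G₀) • (c zi • ν₀) := by rw [smul_smul]
    _ ≤ κ t z := h1

end SmallSet

/-! ### Local small sets from a continuous density -/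

section Density

variable [TopologicalSpace X] [OpensMeasurableSpace X]

/-- **A jointly continuous density gives a local small set** (the first step of the proof of
CEHR Prop. 3.6: "pick any `z₀`… fix `z⋆` such that `p_1(z₀, z⋆) > 0`. By continuity, there exists
`δ > 0` such that `inf_{z ∈ B(z₀,δ)} p_1(z, z⋆) > 0`"): if `κ t (z, ·) = p_t(z, ·) · λ` for `t > 0`
with `(t, z, y) ↦ p_t(z, y)` continuous on `(0, ∞) × X × X`, then for every `t₀ > 0` and `z₀`
there are open sets `G₀ ∋ z₀`, `U₀ ∋ y₀`, a constant `η > 0` and `0 < δ ≤ t₀` with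
`κ t (w, ·) ≥ η · λ|_{U₀}` for all `w ∈ G₀`, `|t - t₀| ≤ δ`.
[cite: CuneoEckmannHairerReyBellet2018, Prop 3.6 (proof)] -/
theorem exists_local_small_of_density (κ : ℝ≥0 → Kernel X X) [∀ t, IsMarkovKernel (κ t)]
    {Λ : Measure X} (p : ℝ≥0 → X → X → ℝ≥0)
    (hp : ContinuousOn (fun q : ℝ≥0 × X × X => p q.1 q.2.1 q.2.2) {q | 0 < q.1})
    (hκ : ∀ t : ℝ≥0, 0 < t → ∀ z, κ t z = Λ.withDensity fun y => p t z y)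
    {t₀ : ℝ≥0} (ht₀ : 0 < t₀) (z₀ : X) :
    ∃ (y₀ : X) (G₀ U₀ : Set X) (η : ℝ≥0∞) (δ : ℝ), IsOpen G₀ ∧ z₀ ∈ G₀ ∧ IsOpen U₀ ∧ y₀ ∈ U₀ ∧
      0 < η ∧ 0 < δ ∧ δ ≤ t₀ ∧
      ∀ t : ℝ≥0, (t₀ : ℝ) - δ ≤ (t : ℝ) → (t : ℝ) ≤ t₀ + δ → ∀ w ∈ G₀,
        η • Λ.restrict U₀ ≤ κ t w := by
  -- a point of positive density
  obtain ⟨y₀, hy₀⟩ : ∃ y₀, 0 < p t₀ z₀ y₀ := by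
    by_contra h
    push Not at h
    have h0 : (fun y => (p t₀ z₀ y : ℝ≥0∞)) = 0 := by
      funext y; simp [nonpos_iff_eq_zero.1 (h y)]
    have := measure_univ (μ := κ t₀ z₀)
    rw [hκ t₀ ht₀ z₀, h0, withDensity_zero] at this
    simp at this
  -- continuity at `(t₀, z₀, y₀)`: `p > p₀/2` on an open box
  set p₀ : ℝ≥0 := p t₀ z₀ y₀ with hp₀
  have hcont : ContinuousAt (fun q : ℝ≥0 × X × X => p q.1 q.2.1 q.2.2) (t₀, z₀, y₀) :=
    hp.continuousAt ((isOpen_lt continuous_const continuous_fst).mem_nhds ht₀)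
  have hpre : (fun q : ℝ≥0 × X × X => p q.1 q.2.1 q.2.2) ⁻¹' Ioi (p₀ / 2) ∈ 𝓝 (t₀, z₀, y₀) :=
    hcont.preimage_mem_nhds (Ioi_mem_nhds (half_lt_self hy₀))
  obtain ⟨T, hT, W, hW, hTW⟩ := mem_nhds_prod_iff.1 hpre
  obtain ⟨G₀, hG₀, U₀, hU₀, hGU⟩ := mem_nhds_prod_iff.1 hW
  obtain ⟨G₁, hG₁G₀, hG₁open, hz₀G₁⟩ := mem_nhds_iff.1 hG₀
  obtain ⟨U₁, hU₁U₀, hU₁open, hy₀U₁⟩ := mem_nhds_iff.1 hU₀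
  obtain ⟨r, hr, hrT⟩ := Metric.mem_nhds_iff.1 hT
  -- the time window `δ = min (r/2) (t₀/2)`
  have ht₀r : (0 : ℝ) < t₀ := by exact_mod_cast ht₀
  set δ : ℝ := min (r / 2) (t₀ / 2) with hδ
  have hδ0 : 0 < δ := lt_min (by positivity) (by positivity)
  have hδt : δ ≤ t₀ := (min_le_right _ _).trans (by linarith)
  refine ⟨y₀, G₁, U₁, (p₀ / 2 : ℝ≥0), δ, hG₁open, hz₀G₁, hU₁open, hy₀U₁,
    by exact_mod_cast half_pos hy₀, hδ0, hδt, fun t ht1 ht2 w hw => ?_⟩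
  -- for `t` in the window and `w ∈ G₁`, `p t w ≥ p₀/2` on `U₁`
  have htT : t ∈ T := by
    refine hrT ?_
    rw [Metric.mem_ball, NNReal.dist_eq, abs_lt]
    have : δ ≤ r / 2 := min_le_left _ _
    constructor <;> linarith
  have hdens : ∀ y ∈ U₁, (p₀ / 2 : ℝ≥0) < p t w y := fun y hy =>
    hTW (mk_mem_prod htT (hGU (mk_mem_prod (hG₁G₀ hw) (hU₁U₀ hy))))
  have htpos : 0 < t := by
    have hδ2 : δ ≤ t₀ / 2 := min_le_right _ _
    have : (0 : ℝ) < t := by linarith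
    exact_mod_cast this
  rw [hκ t htpos w]
  refine Measure.le_iff.2 fun A hA => ?_
  rw [Measure.smul_apply, Measure.restrict_apply hA, withDensity_apply _ hA, smul_eq_mul]
  calc ((p₀ / 2 : ℝ≥0) : ℝ≥0∞) * Λ (A ∩ U₁) = ∫⁻ _ in A ∩ U₁, ((p₀ / 2 : ℝ≥0) : ℝ≥0∞) ∂Λ := by
        rw [setLIntegral_const]
    _ ≤ ∫⁻ y in A ∩ U₁, p t w y ∂Λ :=
        setLIntegral_mono' (hA.inter hU₁open.measurableSet) fun y hy =>
          ENNReal.coe_le_coe.2 (hdens y hy.2).le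
    _ ≤ ∫⁻ y in A, p t w y ∂Λ := lintegral_mono_set inter_subset_left

/-- **CEHR 2018, Proposition 3.6 in abstract form: continuous transition densities +
irreducibility + Feller ⟹ every compact set is small for all large times.** Let `(κ t)` be a
Feller, topologically irreducible Markov semigroup on a nonempty metrisable Borel space whose
kernels have, for `t > 0`, a density `p_t(z, y)` with respect to a reference measure `λ` charging
every nonempty open set, `(t, z, y) ↦ p_t(z, y)` being continuous on `(0,∞) × X × X`. Then there
is a nonempty open set `U₀` such that for every compact `C` there is `t_C` with: for every
`t ≥ t_C` some `ε > 0` satisfies `κ t (z, ·) ≥ ε · λ|_{U₀}` for all `z ∈ C` (in particular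
`ν = ε · λ|_{U₀}` is a nonzero measure minorising `κ t (z, ·)` on `C`, as printed: "for every
compact set `C`, there exists a time `t_C` such that for all `t ≥ t_C`, there exists a
non-negative and non-trivial measure `ν` (which may depend on `t`) such that `P_t(z, ·) ≥ ν` for all
`z ∈ C`"). [cite: CuneoEckmannHairerReyBellet2018, Prop 3.6] -/
theorem exists_smul_restrict_le_of_isCompact [HasOuterApproxClosed X] [Nonempty X]
    (κ : ℝ≥0 → Kernel X X) [∀ t, IsMarkovKernel (κ t)]
    (h_add : ∀ s t : ℝ≥0, κ (s + t) = κ t ∘ₖ κ s)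
    (h_feller : ∀ (t : ℝ≥0) (g : X →ᵇ ℝ), Continuous fun x => ∫ y, g y ∂(κ t x))
    (h_irred : ∀ (z : X) (U : Set X), IsOpen U → U.Nonempty → ∃ t : ℝ≥0, 0 < κ t z U)
    {Λ : Measure X} [Λ.IsOpenPosMeasure] (p : ℝ≥0 → X → X → ℝ≥0)
    (hp : ContinuousOn (fun q : ℝ≥0 × X × X => p q.1 q.2.1 q.2.2) {q | 0 < q.1})
    (hκ : ∀ t : ℝ≥0, 0 < t → ∀ z, κ t z = Λ.withDensity fun y => p t z y) :
    ∃ U₀ : Set X, IsOpen U₀ ∧ U₀.Nonempty ∧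
      ∀ C : Set X, IsCompact C → ∃ t_C : ℝ≥0, ∀ t : ℝ≥0, t_C ≤ t →
        ∃ ε : ℝ≥0∞, 0 < ε ∧ ∀ z ∈ C, ε • Λ.restrict U₀ ≤ κ t z := by
  obtain ⟨z₀⟩ := ‹Nonempty X›
  obtain ⟨y₀, G₀, U₀, η, δ, hG₀, hz₀, hU₀, hy₀, hη, hδ, hδt, hloc⟩ :=
    exists_local_small_of_density κ p hp hκ one_pos z₀
  refine ⟨U₀, hU₀, ⟨y₀, hy₀⟩, fun C hC => ?_⟩
  -- `ν₀ = η • λ|_{U₀}` charges every neighbourhood of `y₀`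
  have hν₀ : ∀ V : Set X, IsOpen V → y₀ ∈ V → 0 < (η • Λ.restrict U₀) V := by
    intro V hV hyV
    rw [Measure.smul_apply, Measure.restrict_apply hV.measurableSet, smul_eq_mul]
    exact ENNReal.mul_pos hη.ne' ((hV.inter hU₀).measure_pos Λ ⟨y₀, hyV, hy₀⟩).ne'
  obtain ⟨t_C, ht_C⟩ := exists_smul_le_of_isCompact κ h_add h_feller h_irred hG₀ ⟨z₀, hz₀⟩ hν₀
    hδ (by exact_mod_cast hδt) (by exact_mod_cast hloc) hC
  refine ⟨t_C, fun t ht => ?_⟩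
  obtain ⟨ε, hε0, -, hε⟩ := ht_C t ht
  refine ⟨ε * η, ENNReal.mul_pos hε0.ne' hη.ne', fun z hz => ?_⟩
  rw [← smul_smul]
  exact hε z hz

end Density


/-! ### Pointed irreducibility: reaching the neighbourhoods of one base point suffices

The proofs above use irreducibility only with target the small open set `G₀`. If the local
small set sits at a base point `x₀ ∈ G₀`, it is therefore enough that every point reaches every
NEIGHBOURHOOD OF `x₀` with positive probability (e.g. `x₀` an attracting equilibrium of the
noiseless dynamics, reached by the support theorem). -/

section Pointed

variable [TopologicalSpace X] [OpensMeasurableSpace X] [HasOuterApproxClosed X]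
  (κ : ℝ≥0 → Kernel X X) [∀ t, IsMarkovKernel (κ t)]
  (h_add : ∀ s t : ℝ≥0, κ (s + t) = κ t ∘ₖ κ s)
  (h_feller : ∀ (t : ℝ≥0) (g : X →ᵇ ℝ), Continuous fun x => ∫ y, g y ∂(κ t x))
  {x₀ : X}
  (h_irred : ∀ (z : X) (U : Set X), IsOpen U → x₀ ∈ U → ∃ t : ℝ≥0, 0 < κ t z U)

include h_add h_feller h_irred in
/-- **Return bounds for all large times, pointed form**: as `exists_forall_le_apply_of_local_small`,
assuming only that every point reaches every neighbourhood of the base point `x₀ ∈ G₀`.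
[cite: CuneoEckmannHairerReyBellet2018, Prop 3.6 (proof)] -/
theorem exists_forall_le_apply_of_local_small_of_mem {G₀ : Set X} (hG₀ : IsOpen G₀) (hx₀ : x₀ ∈ G₀)
    {ν₀ : Measure X} {y₀ : X} (hy₀ : ∀ V : Set X, IsOpen V → y₀ ∈ V → 0 < ν₀ V)
    {t₀ δ : ℝ} (hδ : 0 < δ) (hδt : δ ≤ t₀)
    (h_loc : ∀ t : ℝ≥0, t₀ - δ ≤ (t : ℝ) → (t : ℝ) ≤ t₀ + δ → ∀ w ∈ G₀, ν₀ ≤ κ t w) :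
    ∃ T : ℝ, ∀ u : ℝ≥0, T ≤ (u : ℝ) → ∃ c : ℝ≥0∞, 0 < c ∧ c ≤ 1 ∧ ∀ w ∈ G₀, c ≤ κ u w G₀ := by
  -- return from `y₀` to `G₀`
  obtain ⟨s₀, hs₀⟩ := h_irred y₀ G₀ hG₀ hx₀
  obtain ⟨V₁, c₁, hV₁, hy₀V₁, hc₁, hc₁1, hret⟩ :=
    exists_isOpen_le_apply_of_pos (κ s₀) (h_feller s₀) hG₀ y₀ hs₀
  have hm₁ : 0 < ν₀ V₁ := hy₀ V₁ hV₁ hy₀V₁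
  -- the cycle: land in `V₁` with mass `≥ ν₀ V₁`, come back with probability `≥ c₁`
  set a : ℝ := t₀ - δ + s₀ with ha
  set b : ℝ := t₀ + δ + s₀ with hb
  have ha0 : 0 ≤ a := by rw [ha]; have := s₀.coe_nonneg; linarith
  have hab : a < b := by rw [ha, hb]; linarith
  set c₂ : ℝ≥0∞ := c₁ * ν₀ V₁ with hc₂
  have hc₂0 : 0 < c₂ := ENNReal.mul_pos hc₁.ne' hm₁.ne'
  have hcycle : ∀ u : ℝ≥0, a ≤ (u : ℝ) → (u : ℝ) ≤ b → ∀ w ∈ G₀, c₂ ≤ κ u w G₀ := by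
    intro u hu1 hu2 w hw
    have hus : (s₀ : ℝ) ≤ u := by rw [ha] at hu1; linarith
    set t : ℝ≥0 := u - s₀ with ht
    have htu : u = t + s₀ := by rw [ht, tsub_add_cancel_of_le (by exact_mod_cast hus)]
    have htreal : ((t : ℝ≥0) : ℝ) = u - s₀ := by
      rw [ht, NNReal.coe_sub (by exact_mod_cast hus)]
    have ht1 : t₀ - δ ≤ (t : ℝ) := by rw [htreal]; rw [ha] at hu1; linarith
    have ht2 : (t : ℝ) ≤ t₀ + δ := by rw [htreal]; rw [hb] at hu2; linarith
    have hland : ν₀ V₁ ≤ κ t w V₁ := Measure.le_iff'.1 (h_loc t ht1 ht2 w hw) V₁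
    rw [htu]
    calc c₂ = c₁ * ν₀ V₁ := rfl
      _ ≤ c₁ * κ t w V₁ := mul_le_mul' le_rfl hland
      _ ≤ κ (t + s₀) w G₀ :=
          mul_apply_le_comp_apply κ h_add t s₀ w hG₀.measurableSet fun w' hw' => hret w' hw'
  -- `c₂ ≤ 1`
  have hc₂1 : c₂ ≤ 1 := by
    obtain ⟨w₀, hw₀⟩ : G₀.Nonempty := ⟨x₀, hx₀⟩
    have ht₀0 : 0 ≤ t₀ := hδ.le.trans hδt
    have h1 := hcycle ⟨t₀ + s₀, by have := s₀.coe_nonneg; linarith⟩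
      (by show t₀ - δ + (s₀ : ℝ) ≤ t₀ + s₀; linarith)
      (by show t₀ + (s₀ : ℝ) ≤ t₀ + δ + s₀; linarith) w₀ hw₀
    exact h1.trans prob_le_one
  -- iterate and cover all large times
  have hiter := pow_le_apply_of_window κ h_add hG₀.measurableSet ha0 hab.le hcycle
  refine ⟨max b (a * b / (b - a)), fun u hu => ?_⟩
  obtain ⟨k, hk1, hk2, hk3⟩ := exists_nat_mul_le_le_mul ha0 hab hu
  exact ⟨c₂ ^ k, ENNReal.pow_pos hc₂0 k, pow_le_one' hc₂1 k,
    fun w hw => hiter k hk1 u hk2 hk3 w hw⟩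

include h_add h_feller h_irred in
/-- **Every compact set is small for all large times, pointed form**: as
`exists_smul_le_of_isCompact`, assuming only that every point reaches every neighbourhood of the
base point `x₀ ∈ G₀` of the local small set. [cite: CuneoEckmannHairerReyBellet2018, Prop 3.6] -/
theorem exists_smul_le_of_isCompact_of_mem {G₀ : Set X} (hG₀ : IsOpen G₀) (hx₀ : x₀ ∈ G₀)
    {ν₀ : Measure X} {y₀ : X} (hy₀ : ∀ V : Set X, IsOpen V → y₀ ∈ V → 0 < ν₀ V)
    {t₀ δ : ℝ} (hδ : 0 < δ) (hδt : δ ≤ t₀)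
    (h_loc : ∀ t : ℝ≥0, t₀ - δ ≤ (t : ℝ) → (t : ℝ) ≤ t₀ + δ → ∀ w ∈ G₀, ν₀ ≤ κ t w)
    {C : Set X} (hC : IsCompact C) :
    ∃ t_C : ℝ≥0, ∀ t : ℝ≥0, t_C ≤ t → ∃ ε : ℝ≥0∞, 0 < ε ∧ ε ≤ 1 ∧ ∀ z ∈ C, ε • ν₀ ≤ κ t z := by
  classical
  obtain ⟨Tf, hTf⟩ := exists_forall_le_apply_of_local_small_of_mem κ h_add h_feller h_irred hG₀ hx₀
    hy₀ hδ hδt h_loc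
  have ht₀0 : 0 < t₀ := hδ.trans_le hδt
  set t₀' : ℝ≥0 := ⟨t₀, ht₀0.le⟩ with ht₀'
  have ht₀'coe : (t₀' : ℝ) = t₀ := rfl
  -- landing: for `u ≥ Tf`, `κ (u + t₀) (w, ·) ≥ c(u) ν₀` on `G₀`
  have hland : ∀ u : ℝ≥0, Tf ≤ (u : ℝ) → ∃ c : ℝ≥0∞, 0 < c ∧ c ≤ 1 ∧
      ∀ w ∈ G₀, c • ν₀ ≤ κ (u + t₀') w := by
    intro u hu
    obtain ⟨c, hc0, hc1, hc⟩ := hTf u hu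
    refine ⟨c, hc0, hc1, fun w hw => ?_⟩
    have h1 : (κ u w G₀) • ν₀ ≤ κ (u + t₀') w :=
      smul_le_comp κ h_add u t₀' w G₀ fun w' hw' => h_loc t₀' (by rw [ht₀'coe]; linarith)
        (by rw [ht₀'coe]; linarith) w' hw'
    exact (IsOrderedSMul.smul_le_smul_right _ _ (hc w hw) ν₀).trans h1
  -- each point of `C` reaches `G₀` with uniformly positive probability on a neighbourhood
  have hreach : ∀ z : X, ∃ (s : ℝ≥0) (a : ℝ≥0∞) (Nz : Set X), IsOpen Nz ∧ z ∈ Nz ∧ 0 < a ∧ a ≤ 1 ∧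
      ∀ z' ∈ Nz, a ≤ κ s z' G₀ := by
    intro z
    obtain ⟨s, hs⟩ := h_irred z G₀ hG₀ hx₀
    obtain ⟨V, a, hV, hzV, ha0, ha1, hV'⟩ := exists_isOpen_le_apply_of_pos (κ s) (h_feller s) hG₀ z hs
    exact ⟨s, a, V, hV, hzV, ha0, ha1, hV'⟩
  choose s a Nz hNo hzN ha0 ha1 hbound using hreach
  obtain ⟨F, hFC, hcover⟩ := hC.elim_nhds_subcover Nz fun z _ => (hNo z).mem_nhds (hzN z)
  -- the time `t_C`
  set S : ℝ≥0 := F.sup s with hS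
  have hsS : ∀ z ∈ F, s z ≤ S := fun z hz => Finset.le_sup hz
  set M : ℝ≥0 := ⟨max Tf 0, le_max_right _ _⟩ with hM
  have hMcoe : (M : ℝ) = max Tf 0 := rfl
  refine ⟨M + t₀' + S, fun t ht => ?_⟩
  -- for `z ∈ Nz zᵢ`: `κ t (z, ·) ≥ a zᵢ • c(t - s zᵢ - t₀) • ν₀`
  have hdecomp : ∀ z ∈ F, ∃ u : ℝ≥0, Tf ≤ (u : ℝ) ∧ t = s z + (u + t₀') := by
    intro z hz
    have h1 : s z + t₀' + M ≤ t := by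
      calc s z + t₀' + M ≤ S + t₀' + M := by gcongr; exact hsS z hz
        _ = M + t₀' + S := by ring
        _ ≤ t := ht
    have h2 : s z + t₀' ≤ t := le_trans le_self_add h1
    refine ⟨t - (s z + t₀'), ?_, ?_⟩
    · have hcoe : (((t - (s z + t₀') : ℝ≥0)) : ℝ) = t - (s z + t₀') := NNReal.coe_sub h2
      have h1' : ((s z + t₀' + M : ℝ≥0) : ℝ) ≤ t := by exact_mod_cast h1
      rw [NNReal.coe_add, NNReal.coe_add, hMcoe] at h1'
      rw [hcoe]
      have : Tf ≤ max Tf 0 := le_max_left _ _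
      linarith
    · rw [add_comm (t - (s z + t₀')) t₀', ← add_assoc, add_tsub_cancel_of_le h2]
  choose! u hu ht_eq using hdecomp
  have hc : ∀ z ∈ F, ∃ c : ℝ≥0∞, 0 < c ∧ c ≤ 1 ∧ ∀ w ∈ G₀, c • ν₀ ≤ κ (u z + t₀') w :=
    fun z hz => hland (u z) (hu z hz)
  choose! c hc0 hc1 hcland using hc
  -- `ε = ∏ (a zᵢ * c zᵢ)`
  set ε : ℝ≥0∞ := ∏ z ∈ F, a z * c z with hε
  have hε0 : 0 < ε := by
    rw [hε, pos_iff_ne_zero, Finset.prod_ne_zero_iff]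
    exact fun z hz => mul_ne_zero (ha0 z).ne' (hc0 z hz).ne'
  have hfac1 : ∀ z ∈ F, a z * c z ≤ 1 := fun z hz => mul_le_one' (ha1 z) (hc1 z hz)
  have hε1 : ε ≤ 1 := Finset.prod_le_one' hfac1
  have hεle : ∀ z ∈ F, ε ≤ a z * c z := by
    intro z hz
    rw [hε, ← Finset.mul_prod_erase F (fun z => a z * c z) hz]
    exact mul_le_of_le_one_right' (Finset.prod_le_one' fun w hw => hfac1 w (Finset.mem_of_mem_erase hw))
  refine ⟨ε, hε0, hε1, fun z hz => ?_⟩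
  -- pick the index `zᵢ` with `z ∈ Nz zᵢ`
  obtain ⟨zi, hziF, hzNi⟩ : ∃ zi ∈ F, z ∈ Nz zi := by
    have := hcover hz
    simp only [mem_iUnion, exists_prop] at this
    exact this
  have h1 : (κ (s zi) z G₀) • (c zi • ν₀) ≤ κ (s zi + (u zi + t₀')) z :=
    smul_le_comp κ h_add (s zi) (u zi + t₀') z G₀ fun w hw => hcland zi hziF w hw
  rw [← ht_eq zi hziF] at h1
  calc ε • ν₀ ≤ (a zi * c zi) • ν₀ := IsOrderedSMul.smul_le_smul_right _ _ (hεle zi hziF) ν₀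
    _ ≤ (κ (s zi) z G₀ * c zi) • ν₀ :=
        IsOrderedSMul.smul_le_smul_right _ _ (mul_le_mul' (hbound zi z hzNi) le_rfl) ν₀
    _ = (κ (s zi) z G₀) • (c zi • ν₀) := by rw [smul_smul]
    _ ≤ κ t z := h1

include h_add h_feller h_irred in
/-- **CEHR 2018, Proposition 3.6 in abstract form, pointed version**: continuous transition
densities + Feller + every point reaches every neighbourhood of a base point `x₀` with positive
probability ⟹ for a fixed nonempty open `U₀` and every compact `C`, for all large `t`,
`κ t (z, ·) ≥ ε · λ|_{U₀}` on `C` with some `ε = ε(t) > 0` (the local small set is taken at `x₀`).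
[cite: CuneoEckmannHairerReyBellet2018, Prop 3.6] -/
theorem exists_smul_restrict_le_of_isCompact_of_mem
    {Λ : Measure X} [Λ.IsOpenPosMeasure] (p : ℝ≥0 → X → X → ℝ≥0)
    (hp : ContinuousOn (fun q : ℝ≥0 × X × X => p q.1 q.2.1 q.2.2) {q | 0 < q.1})
    (hκ : ∀ t : ℝ≥0, 0 < t → ∀ z, κ t z = Λ.withDensity fun y => p t z y) :
    ∃ U₀ : Set X, IsOpen U₀ ∧ U₀.Nonempty ∧
      ∀ C : Set X, IsCompact C → ∃ t_C : ℝ≥0, ∀ t : ℝ≥0, t_C ≤ t →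
        ∃ ε : ℝ≥0∞, 0 < ε ∧ ∀ z ∈ C, ε • Λ.restrict U₀ ≤ κ t z := by
  obtain ⟨y₀, G₀, U₀, η, δ, hG₀, hz₀, hU₀, hy₀, hη, hδ, hδt, hloc⟩ :=
    exists_local_small_of_density κ p hp hκ one_pos x₀
  refine ⟨U₀, hU₀, ⟨y₀, hy₀⟩, fun C hC => ?_⟩
  -- `ν₀ = η • λ|_{U₀}` charges every neighbourhood of `y₀`
  have hν₀ : ∀ V : Set X, IsOpen V → y₀ ∈ V → 0 < (η • Λ.restrict U₀) V := by
    intro V hV hyV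
    rw [Measure.smul_apply, Measure.restrict_apply hV.measurableSet, smul_eq_mul]
    exact ENNReal.mul_pos hη.ne' ((hV.inter hU₀).measure_pos Λ ⟨y₀, hyV, hy₀⟩).ne'
  obtain ⟨t_C, ht_C⟩ := exists_smul_le_of_isCompact_of_mem κ h_add h_feller h_irred hG₀ hz₀ hν₀
    hδ (by exact_mod_cast hδt) (by exact_mod_cast hloc) hC
  refine ⟨t_C, fun t ht => ?_⟩
  obtain ⟨ε, hε0, -, hε⟩ := ht_C t ht
  refine ⟨ε * η, ENNReal.mul_pos hε0.ne' hη.ne', fun z hz => ?_⟩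
  rw [← smul_smul]
  exact hε z hz

end Pointed

end Literature.Probability.Process.MarkovSemigroup
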